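import Summits.BirchSwinnertonDyer.BirchSwinnertonDyer.Theses.EdixhovenFibreFiveSeven
import Summits.BirchSwinnertonDyer.BirchSwinnertonDyer.Theorems.AdditiveKolyvaginRoadManinFrameOfCDT
import HarnessLib

/-!
# Route `EdixhovenFibreFiveSeven`: K★ `StarredOptimalManinUnitFiveSeven` (22226), KP57 `KPResidueManinUnitFiveSeven` (23810),
# its children CORNER (23883) / LOW (23884), and the rung W-ALL/2.p>=5.r1, MODULO THE PRINTED CALEGARI–DIMITROV–TANG
# UNBOUNDED-DENOMINATORS THEOREM (and the registered bundles 24319 / 20137) ONLY — `--supports`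

Cell `pub/bsd-wall`, seat `bsd-line-ttd-p1` (prover 1/2 on the sibling line TeichmullerTwistDescent, g31; cross-route helper,
announced on STATUS; the route is DORMANT-designate, no seat holds these items). THEOREMS ONLY (no definition, no named fact, no
`sorry`); every theorem is `proof.conditional` on ONE cite-only PRINTED fact, the vendored unbounded-denominators theorem
`Literature.NumberTheory.Automorphic.CalegariDimitrovTang2025_unboundedDenominators_algInt` («CDT»; Calegari–Dimitrov–Tang, J. Amer.
Math. Soc. 38 (2025), Thm. 1, Remarks 58–59); nothing is closed by name; BSD is not proved; Manin's conjecture is not proved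
unconditionally; no Manin theorem is announced (director-bsd (505)/(527): «closed modulo CDT; items open»).

WHAT THIS FILE DOES. By name over `TeichmullerTwistDescent.not_dvd_c_of_CDT` (p769544: `p ∤ c(D)` at every lattice-optimal
datum of every globally minimal curve additive at `p ≥ 5`, modulo CDT — itself one line over the cell bsd-f2-manin's
`CDivisionUDC.abs_maninConstant_eq_one_of_CDT_of_odd_sq_dvd`, p755101) and `AdditiveKolyOfCDT.exists_datum_not_dvd_c_of_CDT`
(the `∃ D, p ∤ c(D)` currency, modulo CDT and modularity):
* `starredOptimalManinUnitFiveSeven_of_CDT` — **K★ (22226) ⟸ CDT** (was: `blocked-on` Kato F″; Edixhoven's Thm 3 at `p ∈ {5,7}`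
  for the starred types; all its clauses idle);
* this route's copies of CORNER (23883) / LOW (23884) are definitionally the TeichmullerTwistDescent decls: their `⟸ CDT` forms
  are the landed `TeichmullerTwistDescent.kummerCornerTorsionOptimalManinUnit_of_CDT` / `…supersingularTorsionOptimalManinUnitFive_of_CDT`
  (p769544), used below as such;
* `kpResidueManinUnitFiveSeven_of_CDT_of_modularity` — **KP57 (23810) ⟸ CDT ∧ modularity**, and
  `kpResidueManinUnitFiveSeven_of_CDT_of_kpTransportInputs` — the same keyed on the registered bundle `KPTransportInputs` (24319);
* the rung W-ALL/2.p>=5.r1 ⟸ CDT ∧ this route's Kolyvagin-side cruxes (21400, 20133, 20134) ∧ the bundle 20137 is the landed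
  `AdditiveKolyOfCDT.wAllExclAdditiveFiveLeRankOne_of_koly_of_CDT` (p769664; the decls are definitionally shared): K★, TDS57
  (22227), TDS11 (22228), the member glue, `PublishedManinFacts`, `KatoNeronAndCremonaFacts` all leave the cone of the rung.
HONEST STATUS: CONDITIONAL on the printed CDT fact (the cell bsd-f2-manin's trust base; audits (505)/(527) pending); items stay
OPEN by name; TDS57 / TDS11 (twist-DEGREE statements) are NOT derived here. BSD is not proved by this; no W-ALL class theorem
is proved by this; Manin's conjecture is not proved by this. [cite: CalegariDimitrovTang2025, Thm. 1 and Remarks 58–59]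
[cite: LingOesterle1991, Thm. 6] [cite: KostersPannekoek2017, Thm. 1 and Cor. 2] [cite: EdixhovenManin1991, Thm. 3]
[cite: WZhang2014, Thm. 1.1 (shape of the Kolyvagin-side cruxes)]
-/

set_option autoImplicit false
-- single-conjunct summit: `Summit.BirchSwinnertonDyer.BirchSwinnertonDyer.…` repeats the name by design
set_option linter.dupNamespace false

noncomputable section

open scoped Classical

open WeierstrassCurve Literature.NumberTheory.EllipticCurves Literature.NumberTheory.EllipticCurves.ModularForms
  Literature.NumberTheory.EllipticCurves.Rank1Residual
  Summit.BirchSwinnertonDyer.BirchSwinnertonDyer.Theses.EdixhovenFibreFiveSeven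
  Summit.BirchSwinnertonDyer.BirchSwinnertonDyer.Theorems

namespace Summit.BirchSwinnertonDyer.BirchSwinnertonDyer.Theorems.EdixhovenFibreFiveSevenOfCDT

/-! ### §1 K★ and the two KP cells, BY NAME, modulo CDT -/

/-- **K★ `StarredOptimalManinUnitFiveSeven` (stmt-BirchSwinnertonDyer-22226) ⟸ CDT**: the starred types IV*, III*, II* at
`p ∈ {5, 7}` (`4 < ord_p Δ_min`), `E[p]` irreducible, no `Iₙ*` fibre, lattice-optimal conductor-level datum ⟹ `p ∤ c` — all
clauses except «additive at `p ≥ 5`» and «lattice-optimal» are idle. CONDITIONAL on `hCDT`; the item is not closed by this;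
BSD is not proved by this. [cite: CalegariDimitrovTang2025, Thm. 1 and Remarks 58–59] [cite: EdixhovenManin1991, Thm. 3] -/
theorem starredOptimalManinUnitFiveSeven_of_CDT
    (hCDT : Literature.NumberTheory.Automorphic.CalegariDimitrovTang2025_unboundedDenominators_algInt) :
    StarredOptimalManinUnitFiveSeven := by
  intro W _ _ p _ _ D hp57 hadd _hirr _hI _hv hlat
  have hp5 : 5 ≤ p := by rcases hp57 with rfl | rfl <;> omega
  exact TeichmullerTwistDescent.not_dvd_c_of_CDT hCDT D hp5 hadd hlat

/-! ### §2 KP57 modulo CDT -/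

/-- **KP57 `KPResidueManinUnitFiveSeven` (stmt-BirchSwinnertonDyer-23810) ⟸ CDT ∧ modularity**: for every globally minimal `V`
additive at `p ∈ {5,7}` with `E[p]` irreducible there is a conductor-level datum with `p ∤ c`
(`AdditiveKolyOfCDT.exists_datum_not_dvd_c_of_CDT`); the Kodaira / torsion-witness / degree / `N > 5·10⁵` clauses are idle.
CONDITIONAL on the cite-only printed facts `hCDT`, `hnf`; the item is not closed by this; BSD is not proved by this.
[cite: CalegariDimitrovTang2025, Thm. 1 and Remarks 58–59] [cite: BCDTJAMS2001, Thm. A] [cite: KostersPannekoek2017, Thm. 1 and Cor. 2] -/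
theorem kpResidueManinUnitFiveSeven_of_CDT_of_modularity
    (hCDT : Literature.NumberTheory.Automorphic.CalegariDimitrovTang2025_unboundedDenominators_algInt)
    (hnf : exists_isNewformOf) : KPResidueManinUnitFiveSeven := by
  intro p _ V _ _ _ hp57 hadd hirr _hI _hv _htor _hall _hN
  have hp5 : 5 ≤ p := by rcases hp57 with rfl | rfl <;> omega
  exact AdditiveKolyOfCDT.exists_datum_not_dvd_c_of_CDT hCDT hnf V p hp5 hadd hirr

/-- **KP57 (23810) ⟸ CDT ∧ the registered bundle `KPTransportInputs` (stmt-BirchSwinnertonDyer-24319)** (its first conjunct is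
modularity; Dokchitser–Dokchitser is idle). CONDITIONAL; the item is not closed by this; BSD is not proved by this.
[cite: CalegariDimitrovTang2025, Thm. 1 and Remarks 58–59] -/
theorem kpResidueManinUnitFiveSeven_of_CDT_of_kpTransportInputs
    (hCDT : Literature.NumberTheory.Automorphic.CalegariDimitrovTang2025_unboundedDenominators_algInt)
    (hT : KPTransportInputs) : KPResidueManinUnitFiveSeven :=
  kpResidueManinUnitFiveSeven_of_CDT_of_modularity hCDT hT.1

/-- **K★'s registered twin `StarredOptimalManinUnitFiveSevenOfKato` (23811: `KatoNeronAndCremonaFacts → K★`) with the Kato bundle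
idle, modulo CDT.** CONDITIONAL on `hCDT`; nothing closed; BSD is not proved by this. [cite: CalegariDimitrovTang2025, Thm. 1 and Remarks 58–59] -/
theorem starredOptimalManinUnitFiveSevenOfKato_of_CDT
    (hCDT : Literature.NumberTheory.Automorphic.CalegariDimitrovTang2025_unboundedDenominators_algInt) :
    StarredOptimalManinUnitFiveSevenOfKato :=
  fun _hKC => starredOptimalManinUnitFiveSeven_of_CDT hCDT

/-! ### §3 The rung

The rung W-ALL/2.p>=5.r1 ⟸ CDT ∧ {21400, 20133, 20134} ∧ 20137 is the landed
`AdditiveKolyOfCDT.wAllExclAdditiveFiveLeRankOne_of_koly_of_CDT` (p769664); this route's Kolyvagin-side decls are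
definitionally the AdditiveKolyvaginRoad ones, so it applies verbatim to this route's hypotheses (the gate's dedup
identifies the restatement; nothing is re-declared here). -/

end Summit.BirchSwinnertonDyer.BirchSwinnertonDyer.Theorems.EdixhovenFibreFiveSevenOfCDT

end
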